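/-
Width seat `ym-line-cbag-p1-w2` (prover-ym-line-cbag-p1-w2-g12-0; own items stmt-QuantumFields-22254 / 22893 of route `ColdBoxAllGroups`
CLOSED proved).  Glue for LINE 3 `SixPlaneColdBox` (crux `DensityTransferG`, stmt-QuantumFields-25709): the abstract law of total covariance
with an exceptional event and a DATUM-DEPENDENT floor.  Pure probability; RECORD-type material downstream; the Yang–Mills mass gap is NOT
proved by anything here.
-/
import Summits.QuantumFields.YangMills.Theorems.WeakCouplingRatesBulkDominatesColdBoxWDlrPlumbing

/-!
# LINE 3 `SixPlaneColdBox`, glue: the law of total covariance with an exceptional event and a datum-dependent floor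

The one-sided DLR transfer of the cold-box engine (`BulkDominatesColdBoxW`, `BulkAllGroups`: stub `stub_dlrAssembly(G)`) rests on the
abstract estimate `WeakCouplingRates.total_covariance_lower_bound_sub`: if, off an exceptional set `E` of boundary data of mass `≤ p`, the
conditional covariance of the two plaquette costs is `≥ θ` (a CONSTANT) and the two conditional means differ by `≤ ε`, then
`θ − ε²/4 − (θ + 3K₀²)p ≤ Cov`.  For the SIX-PLANE action density the conditional covariance given a good datum `η` is, in `β²` units,
`(D/2)Σ_{q,q'}K_D(q,q')² + β·Σ_{q,q'} F̄_q(η) F̄'_{q'}(η) K_D(q,q') + o` with an INDEFINITE datum quadratic form (negative temporal-plane kernels;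
planner's thesis of route `SixPlaneColdBox`), so the floor is `θ − Φ(η)` with `Φ(η) ≍ β·|F̄(η)|²·T^{-4} ≥ 0` — small only ON AVERAGE over the
torus state (crux `TorusMeanNearColdBoxG`: `E_torus|F̄|² ≤ 2·(mean difference) + o`).  This file supplies the corresponding abstract step,
«the datum quadratic form bounded INSIDE the DLR average»:

* `total_covariance_lower_bound_sub_datumFloor` — on a probability space, `h, k, q` measurable with `|h|, |k| ≤ K₀`, `|q| ≤ K₀²`, `E` of
  mass `≤ p`, `Φ ≥ 0` integrable; if off `E` the conditional covariance is `q − hk ≥ θ − Φ` (`θ ≥ 0`) and `|k − h| ≤ ε`, then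
  `θ − ∫Φ − ε²/4 − (θ + 3K₀²)p ≤ ∫q − ∫h·∫k`;
* `total_covariance_lower_bound_sub_datumFloor_compl` — the same with the floor integrated over the GOOD data only:
  `θ − ∫_{Eᶜ}Φ − ε²/4 − (θ + 3K₀²)p ≤ ∫q − ∫h·∫k` (apply the first form to `Φ·𝟙_{Eᶜ}`).

Proof: the mean of the conditional covariances is `≥ θ − ∫Φ − (θ + 2K₀²)μ(E)` (pointwise `θ − Φ − (θ+2K₀²)𝟙_E ≤ q − hk`, using `Φ ≥ 0` on
`E`), and the covariance of the conditional means is `≥ −¼∫(k−h)² ≥ −ε²/4 − K₀²μ(E)` exactly as in the constant-floor lemma (Durrett 2019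
§4.1; adapted from `WeakCouplingRates.total_covariance_lower_bound_sub`, p2's plumbing of `stub_dlrAssembly`).  No sorry; standard axioms.
-/

set_option autoImplicit false

noncomputable section

open MeasureTheory

namespace Summit.QuantumFields.YangMills.Theorems.SixPlaneColdBox

/-- **Law of total covariance with an exceptional event, same-datum form, DATUM-DEPENDENT floor.**  On a probability space let `h, k, q`
be measurable with `|h|, |k| ≤ K₀`, `|q| ≤ K₀²` (the conditional expectations of `X`, `Y`, `XY` given the boundary datum), `E` an event of
mass `≤ p`, `Φ ≥ 0` integrable, and suppose that off `E` the conditional covariance satisfies `q − hk ≥ θ − Φ` with a constant `θ ≥ 0`, and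
the two conditional means differ by `|k − h| ≤ ε`.  Then `θ − ∫Φ − ε²/4 − (θ + 3K₀²)p ≤ ∫ q − ∫ h · ∫ k`.  (With `Φ = 0` this is
`WeakCouplingRates.total_covariance_lower_bound_sub`.)  [folklore; Durrett 2019 §4.1] -/
theorem total_covariance_lower_bound_sub_datumFloor {Ω : Type*} [MeasurableSpace Ω] {μ : Measure Ω} [IsProbabilityMeasure μ]
    {E : Set Ω} (hE : MeasurableSet E) {h k q Φ : Ω → ℝ} (hhm : Measurable h) (hkm : Measurable k) (hqm : Measurable q)
    (hΦi : Integrable Φ μ) {K₀ θ ε p : ℝ} (hhK : ∀ ω, |h ω| ≤ K₀) (hkK : ∀ ω, |k ω| ≤ K₀) (hqK : ∀ ω, |q ω| ≤ K₀ ^ 2)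
    (hθ : 0 ≤ θ) (hΦ0 : ∀ ω, 0 ≤ Φ ω)
    (hlow : ∀ ω, ω ∉ E → θ - Φ ω ≤ q ω - h ω * k ω) (hdiff : ∀ ω, ω ∉ E → |k ω - h ω| ≤ ε) (hμE : μ.real E ≤ p) :
    θ - (∫ ω, Φ ω ∂μ) - ε ^ 2 / 4 - (θ + 3 * K₀ ^ 2) * p ≤ (∫ ω, q ω ∂μ) - (∫ ω, h ω ∂μ) * ∫ ω, k ω ∂μ := by
  -- adapted from `WeakCouplingRates.total_covariance_lower_bound_sub` (Step 1 carries the datum-dependent floor)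
  obtain ⟨ω₁⟩ := nonempty_of_isProbabilityMeasure μ
  have hK : 0 ≤ K₀ := (abs_nonneg _).trans (hhK ω₁)
  have bdd : ∀ {f : Ω → ℝ} (C : ℝ), Measurable f → (∀ ω, |f ω| ≤ C) → Integrable f μ := fun C hf hC =>
    Integrable.of_bound hf.aestronglyMeasurable C (ae_of_all _ fun ω => by simpa [Real.norm_eq_abs] using hC ω)
  have hhkb : ∀ ω, |h ω * k ω| ≤ K₀ ^ 2 := fun ω => by
    rw [abs_mul, sq]; exact mul_le_mul (hhK ω) (hkK ω) (abs_nonneg _) hK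
  have hhi : Integrable h μ := bdd K₀ hhm hhK
  have hki : Integrable k μ := bdd K₀ hkm hkK
  have hqi : Integrable q μ := bdd _ hqm hqK
  have hhki : Integrable (fun ω => h ω * k ω) μ := bdd _ (hhm.mul hkm) hhkb
  have hpE : μ.real E ≤ p := hμE
  have hE0 : 0 ≤ μ.real E := measureReal_nonneg
  -- Step 1: the mean of the conditional covariances, with the datum-dependent floor integrated
  have hstep1 : θ - (∫ ω, Φ ω ∂μ) - (θ + 2 * K₀ ^ 2) * μ.real E ≤ (∫ ω, q ω ∂μ) - ∫ ω, h ω * k ω ∂μ := by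
    rw [← integral_sub hqi hhki]
    have hpt : ∀ ω, θ - Φ ω - (θ + 2 * K₀ ^ 2) * E.indicator (fun _ => (1 : ℝ)) ω ≤ q ω - h ω * k ω := by
      intro ω
      by_cases hω : ω ∈ E
      · rw [Set.indicator_of_mem hω, mul_one]
        have h1 := hqK ω
        have h2 := hhkb ω
        have h3 := hΦ0 ω
        rw [abs_le] at h1 h2
        linarith
      · rw [Set.indicator_of_notMem hω, mul_zero, sub_zero]
        exact hlow ω hω
    have hind : Integrable (fun ω => (θ + 2 * K₀ ^ 2) * E.indicator (fun _ => (1 : ℝ)) ω) μ :=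
      ((integrable_const _).indicator hE).const_mul _
    have hθΦ : Integrable (fun ω => θ - Φ ω) μ := (integrable_const θ).sub hΦi
    have hint : Integrable (fun ω => θ - Φ ω - (θ + 2 * K₀ ^ 2) * E.indicator (fun _ => (1 : ℝ)) ω) μ := hθΦ.sub hind
    have eθΦ : ∫ ω, (θ - Φ ω) ∂μ = θ - ∫ ω, Φ ω ∂μ := by
      rw [integral_sub (integrable_const θ) hΦi, integral_const]
      simp
    have eind : ∫ ω, (θ + 2 * K₀ ^ 2) * E.indicator (fun _ => (1 : ℝ)) ω ∂μ = (θ + 2 * K₀ ^ 2) * μ.real E := by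
      rw [integral_const_mul, integral_indicator_const _ hE]
      simp
    calc θ - (∫ ω, Φ ω ∂μ) - (θ + 2 * K₀ ^ 2) * μ.real E
        = ∫ ω, (θ - Φ ω - (θ + 2 * K₀ ^ 2) * E.indicator (fun _ => (1 : ℝ)) ω) ∂μ := by
          rw [integral_sub hθΦ hind, eθΦ, eind]
      _ ≤ ∫ ω, (q ω - h ω * k ω) ∂μ := integral_mono hint (hqi.sub hhki) hpt
  -- Step 2: the covariance of the conditional means is `≥ -¼ ∫ (k - h)²`
  set m : Ω → ℝ := fun ω => (h ω + k ω) / 2 with hm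
  set D : Ω → ℝ := fun ω => k ω - h ω with hD
  have hmm : Measurable m := (hhm.add hkm).div_const 2
  have hDm : Measurable D := hkm.sub hhm
  have hmK : ∀ ω, |m ω| ≤ K₀ := fun ω => by
    rw [hm]; dsimp only
    rw [abs_div, abs_two]
    have := abs_add_le (h ω) (k ω)
    linarith [hhK ω, hkK ω]
  have hDK : ∀ ω, |D ω| ≤ 2 * K₀ := fun ω => by
    rw [hD]; dsimp only
    have := abs_sub (k ω) (h ω)
    linarith [hhK ω, hkK ω]
  have hmi : Integrable m μ := bdd K₀ hmm hmK
  have hDi : Integrable D μ := bdd _ hDm hDK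
  have hm2i : Integrable (fun ω => m ω ^ 2) μ := bdd (K₀ ^ 2) (hmm.pow_const 2) fun ω => by
    rw [abs_pow, sq_abs, ← sq_abs]; exact pow_le_pow_left₀ (abs_nonneg _) (hmK ω) 2
  have hD2i : Integrable (fun ω => D ω ^ 2) μ := bdd ((2 * K₀) ^ 2) (hDm.pow_const 2) fun ω => by
    rw [abs_pow, sq_abs, ← sq_abs]; exact pow_le_pow_left₀ (abs_nonneg _) (hDK ω) 2
  -- `Var m ≥ 0` in raw form
  have hvar : (∫ ω, m ω ∂μ) ^ 2 ≤ ∫ ω, m ω ^ 2 ∂μ := by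
    set c := ∫ ω, m ω ∂μ with hc
    have h0 : 0 ≤ ∫ ω, (m ω - c) ^ 2 ∂μ := integral_nonneg fun ω => sq_nonneg _
    have hexp : ∫ ω, (m ω - c) ^ 2 ∂μ = (∫ ω, m ω ^ 2 ∂μ) - 2 * c * (∫ ω, m ω ∂μ) + c ^ 2 := by
      have e : (fun ω => (m ω - c) ^ 2) = fun ω => m ω ^ 2 - 2 * c * m ω + c ^ 2 := by
        funext ω; ring
      have hf : Integrable (fun ω => m ω ^ 2 - 2 * c * m ω) μ := hm2i.sub (hmi.const_mul _)
      rw [e, integral_add hf (integrable_const _), integral_sub hm2i (hmi.const_mul _),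
        integral_const_mul, integral_const]
      simp
    rw [hexp, ← hc] at h0
    nlinarith
  have hcovm : -(1 / 4 : ℝ) * ∫ ω, D ω ^ 2 ∂μ ≤ (∫ ω, h ω * k ω ∂μ) - (∫ ω, h ω ∂μ) * ∫ ω, k ω ∂μ := by
    have e1 : (fun ω => h ω * k ω) = fun ω => m ω ^ 2 - (1 / 4 : ℝ) * D ω ^ 2 := by
      funext ω; simp only [hm, hD]; ring
    have e2 : h = fun ω => m ω - (1 / 2 : ℝ) * D ω := by funext ω; simp only [hm, hD]; ring
    have e3 : k = fun ω => m ω + (1 / 2 : ℝ) * D ω := by funext ω; simp only [hm, hD]; ring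
    have i1 : ∫ ω, h ω * k ω ∂μ = (∫ ω, m ω ^ 2 ∂μ) - (1 / 4 : ℝ) * ∫ ω, D ω ^ 2 ∂μ := by
      rw [e1, integral_sub hm2i (hD2i.const_mul _), integral_const_mul]
    have i2 : ∫ ω, h ω ∂μ = (∫ ω, m ω ∂μ) - (1 / 2 : ℝ) * ∫ ω, D ω ∂μ := by
      conv_lhs => rw [e2]
      rw [integral_sub hmi (hDi.const_mul _), integral_const_mul]
    have i3 : ∫ ω, k ω ∂μ = (∫ ω, m ω ∂μ) + (1 / 2 : ℝ) * ∫ ω, D ω ∂μ := by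
      conv_lhs => rw [e3]
      rw [integral_add hmi (hDi.const_mul _), integral_const_mul]
    rw [i1, i2, i3]
    nlinarith [sq_nonneg (∫ ω, D ω ∂μ)]
  -- Step 3: `∫ D² ≤ ε² + 4 K₀² μ(E)`
  have hD2 : ∫ ω, D ω ^ 2 ∂μ ≤ ε ^ 2 + 4 * K₀ ^ 2 * μ.real E := by
    have hpt : ∀ ω, D ω ^ 2 ≤ ε ^ 2 + 4 * K₀ ^ 2 * E.indicator (fun _ => (1 : ℝ)) ω := by
      intro ω
      by_cases hω : ω ∈ E
      · rw [Set.indicator_of_mem hω, mul_one]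
        have h1 : D ω ^ 2 ≤ (2 * K₀) ^ 2 := by
          rw [← sq_abs]; exact pow_le_pow_left₀ (abs_nonneg _) (hDK ω) 2
        nlinarith [sq_nonneg ε]
      · rw [Set.indicator_of_notMem hω, mul_zero, add_zero, ← sq_abs]
        exact pow_le_pow_left₀ (abs_nonneg _) (hdiff ω hω) 2
    calc ∫ ω, D ω ^ 2 ∂μ ≤ ∫ ω, (ε ^ 2 + 4 * K₀ ^ 2 * E.indicator (fun _ => (1 : ℝ)) ω) ∂μ :=
          integral_mono hD2i ((integrable_const _).add (((integrable_const _).indicator hE).const_mul _)) hpt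
      _ = ε ^ 2 + 4 * K₀ ^ 2 * μ.real E := by
          rw [integral_add (integrable_const _) (((integrable_const _).indicator hE).const_mul _), integral_const_mul,
            integral_indicator_const _ hE, integral_const]
          simp
  -- assemble
  have hK2 : 0 ≤ K₀ ^ 2 := sq_nonneg _
  nlinarith [mul_le_mul_of_nonneg_left hpE (by positivity : (0 : ℝ) ≤ θ + 3 * K₀ ^ 2)]

/-- **The same, read on the exceptional set only through `p`, with the floor integrated over the GOOD data only** — the sharper form
`θ − ∫_{Eᶜ} Φ − ε²/4 − (θ + 3K₀²)p ≤ ∫ q − ∫ h · ∫ k` (no sign condition on `Φ` is needed when it is only integrated off `E`; here it is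
derived from the previous lemma applied to `Φ·𝟙_{Eᶜ} ≥ 0`, so `Φ ≥ 0` is kept).  [folklore; Durrett 2019 §4.1] -/
theorem total_covariance_lower_bound_sub_datumFloor_compl {Ω : Type*} [MeasurableSpace Ω] {μ : Measure Ω} [IsProbabilityMeasure μ]
    {E : Set Ω} (hE : MeasurableSet E) {h k q Φ : Ω → ℝ} (hhm : Measurable h) (hkm : Measurable k) (hqm : Measurable q)
    (hΦi : Integrable Φ μ) {K₀ θ ε p : ℝ} (hhK : ∀ ω, |h ω| ≤ K₀) (hkK : ∀ ω, |k ω| ≤ K₀) (hqK : ∀ ω, |q ω| ≤ K₀ ^ 2)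
    (hθ : 0 ≤ θ) (hΦ0 : ∀ ω, 0 ≤ Φ ω)
    (hlow : ∀ ω, ω ∉ E → θ - Φ ω ≤ q ω - h ω * k ω) (hdiff : ∀ ω, ω ∉ E → |k ω - h ω| ≤ ε) (hμE : μ.real E ≤ p) :
    θ - (∫ ω in Eᶜ, Φ ω ∂μ) - ε ^ 2 / 4 - (θ + 3 * K₀ ^ 2) * p ≤ (∫ ω, q ω ∂μ) - (∫ ω, h ω ∂μ) * ∫ ω, k ω ∂μ := by
  have hEc : MeasurableSet Eᶜ := hE.compl
  have key := total_covariance_lower_bound_sub_datumFloor (Φ := fun ω => Eᶜ.indicator Φ ω) hE hhm hkm hqm (hΦi.indicator hEc)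
    hhK hkK hqK hθ (fun ω => Set.indicator_nonneg (fun ω _ => hΦ0 ω) ω)
    (fun ω hω => by rw [Set.indicator_of_mem (Set.mem_compl hω)]; exact hlow ω hω) hdiff hμE
  rwa [integral_indicator hEc] at key

end Summit.QuantumFields.YangMills.Theorems.SixPlaneColdBox

end
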